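import Summits.ValiantsHypothesis.ValiantsHypothesis.Theorems.LacunarySymmetroidMatrixDescartesCensusTropicalKLawSlopes

/-!
# Route «KPlusLogSqLaw», crux `TropicalB` (stmt-ValiantsHypothesis-19771) — the ONE-STEP CLASS-ADDITION LAW from the thin end implies
# the tropical `K + log² m` law

HONEST FRAMING.  Helper file of the object-search cell `pub-symmetroid` (seat val-sym-trop-p3 g12, 2026-08-28), landed `--supports` the crux
`Summit.ValiantsHypothesis.ValiantsHypothesis.Theses.KPlusLogSqLaw.TropicalB` (item `stmt-ValiantsHypothesis-19771`; in census currency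
`TropicalCensus.TropKPlusLogSqLaw`, `Iff.rfl`-equal to the crux by the route file).  It proves an IMPLICATION between statements that are
OPEN; it does not assert its hypothesis, closes nothing, and says nothing about `TropicalB` in its window, `WeakLifting`, the doors,
`MatrixDescartes` (stmt-ValiantsHypothesis-18050) or `VP ≠ VNP`.

THE STATEMENT.  Call CLASS ADDITION FROM THE THIN END with constant `C` the law
  `∀ m K B, ⌊log₂ m⌋ + 1 ≤ K → TropRootLawAt m K B → TropRootLawAt m (K+1) (2^C·(B+1) − 1)`
(«beyond the thin end `K = ⌊log₂ m⌋ + 1`, where the law is a theorem with `C = 3` (`tropRootLawAt_offWindow`), ONE MORE SLOPE CLASS COSTS AT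
MOST `C` BITS of breakpoints»).  Then:
* `ClassAddition.tropRootLawAt_iter` — iterating from the thin end: `TropRootLawAt m (⌊log₂ m⌋+1+j) (2^(C·j) · 2^(3(⌊log₂ m⌋+1+⌊log₂ m⌋²)+1) − 1)`;
* `ClassAddition.tropKPlusLogSqLaw_of_classAddition` — **the law implies `TropKPlusLogSqLaw` with constant `C + 4`.**
WHY THE THRESHOLD DEPENDS ON `m` (and must): with an `m`-INDEPENDENT threshold `K₀` every such law — even the coarser `K`-doubling form — is
FALSE (tree: `KDoubling.not_kDoublingLawFrom`, killed by the staircase family, whose breakpoint count grows like `m^{(K−1)/2}` at fixed `K`);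
the staircase says nothing at `K > ⌊log₂ m⌋` (its size exceeds `4^K`), so the thin-end form is not refuted by anything in the tree.  HONEST
LABEL: the law is a STRENGTHENING of the crux in local (inductive-in-`K`) form — the crux bounds `T(m,K+1)` absolutely, not relative to the actual
`T(m,K)` — recorded as the finest one-step statement whose iteration gives the crux, NOT as an equivalent re-dressing and NOT as a claim.

[folklore] iteration of a one-step growth bound; packaging of the cell.
-/

set_option linter.dupNamespace false
set_option autoImplicit false

namespace Summit.ValiantsHypothesis.ValiantsHypothesis.Theorems.KPlusLogSqLaw

open Summit.ValiantsHypothesis.ValiantsHypothesis.Theorems.LacunarySymmetroidMatrixDescartes.TropicalCensus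

namespace ClassAddition

/-- **Iterating one-step class addition from the thin end.**  If beyond `K = ⌊log₂ m⌋ + 1` one more class costs at most `C` bits, then for every
`j`, `TropRootLawAt m (⌊log₂ m⌋ + 1 + j) (2^(C·j) · A − 1)` with `A = 2^(3·(⌊log₂ m⌋ + 1 + ⌊log₂ m⌋²) + 1)` (the thin-end bound plus one,
`tropRootLawAt_offWindow`). [folklore] -/
theorem tropRootLawAt_iter (C : ℕ)
    (h : ∀ m K B : ℕ, Nat.log 2 m + 1 ≤ K → TropRootLawAt m K B → TropRootLawAt m (K + 1) (2 ^ C * (B + 1) - 1))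
    (m j : ℕ) :
    TropRootLawAt m (Nat.log 2 m + 1 + j) (2 ^ (C * j) * 2 ^ (3 * (Nat.log 2 m + 1 + Nat.log 2 m ^ 2) + 1) - 1) := by
  induction j with
  | zero =>
    have h0 := tropRootLawAt_offWindow m (Nat.log 2 m + 1) (Or.inl le_rfl)
    rw [Nat.add_zero, Nat.mul_zero, pow_zero, one_mul]
    refine tropRootLawAt_mono ?_ h0
    have hX : 1 ≤ 2 ^ (3 * (Nat.log 2 m + 1 + Nat.log 2 m ^ 2)) := Nat.one_le_two_pow
    rw [pow_succ]
    omega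
  | succ j ih =>
    have hstep := h m (Nat.log 2 m + 1 + j) _ (by omega) ih
    have hpos : 1 ≤ 2 ^ (C * j) * 2 ^ (3 * (Nat.log 2 m + 1 + Nat.log 2 m ^ 2) + 1) :=
      Nat.one_le_iff_ne_zero.mpr (Nat.mul_ne_zero (pow_ne_zero _ two_ne_zero) (pow_ne_zero _ two_ne_zero))
    have heq : 2 ^ C * (2 ^ (C * j) * 2 ^ (3 * (Nat.log 2 m + 1 + Nat.log 2 m ^ 2) + 1) - 1 + 1) - 1 =
        2 ^ (C * (j + 1)) * 2 ^ (3 * (Nat.log 2 m + 1 + Nat.log 2 m ^ 2) + 1) - 1 := by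
      rw [Nat.sub_add_cancel hpos, ← mul_assoc, ← pow_add]
      congr 2; ring
    rw [show Nat.log 2 m + 1 + (j + 1) = Nat.log 2 m + 1 + j + 1 from by ring, ← heq]
    exact hstep

/-- **One-step class addition from the thin end implies the tropical `K + log² m` law** (with constant `C + 4`).  Off the thin end
(`K ≤ ⌊log₂ m⌋ + 1`) the law is `tropRootLawAt_offWindow`; beyond it, iterate (`tropRootLawAt_iter`) and absorb the thin-end constant:
`C·(K − L − 1) + 3(L + 1 + L²) + 1 ≤ (C + 4)·(K + L²)`. [folklore] -/
theorem tropKPlusLogSqLaw_of_classAddition (C : ℕ)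
    (h : ∀ m K B : ℕ, Nat.log 2 m + 1 ≤ K → TropRootLawAt m K B → TropRootLawAt m (K + 1) (2 ^ C * (B + 1) - 1)) :
    TropKPlusLogSqLaw := by
  refine ⟨C + 4, fun m K => ?_⟩
  set L := Nat.log 2 m with hL
  by_cases hK : K ≤ L + 1
  · refine tropRootLawAt_mono (Nat.pow_le_pow_right (by norm_num) ?_) (tropRootLawAt_offWindow m K (Or.inl hK))
    nlinarith [Nat.zero_le K, Nat.zero_le (L ^ 2)]
  · push Not at hK
    obtain ⟨j, hj⟩ : ∃ j, K = L + 1 + j := ⟨K - (L + 1), by omega⟩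
    have hit := tropRootLawAt_iter C h m j
    rw [← hL, ← hj] at hit
    refine tropRootLawAt_mono ?_ hit
    calc 2 ^ (C * j) * 2 ^ (3 * (L + 1 + L ^ 2) + 1) - 1
        ≤ 2 ^ (C * j) * 2 ^ (3 * (L + 1 + L ^ 2) + 1) := Nat.sub_le _ _
      _ = 2 ^ (C * j + (3 * (L + 1 + L ^ 2) + 1)) := by rw [← pow_add]
      _ ≤ 2 ^ ((C + 4) * (K + L ^ 2)) := Nat.pow_le_pow_right (by norm_num) (by nlinarith [Nat.zero_le C, Nat.zero_le L])

end ClassAddition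

end Summit.ValiantsHypothesis.ValiantsHypothesis.Theorems.KPlusLogSqLaw
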